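import Summits.BirchSwinnertonDyer.Rank1Residual.Additive.WildThreeResidualShape
import Summits.BirchSwinnertonDyer.Rank1Residual.Additive.FouquetWanPointTransport
import HarnessLib

/-!
# V10-SHAPE laws at a wild `3`: the SHAPE LAW by `(v₃N, Kodaira)`, the PARTNER law, the
# sub-partition (A) LocIrr / (B) ordinary-type / (C) ω-twisted-type of the O6 residue R-O6-5′, and
# the NON-GENERIC transport SHAPE T-O6-NG over the interface `KMC`
# (cell `b2b-bsdres`, lane CLASS-CLOSURE, class O6, seat cc-typer-5 GEN 7 = O5/O6 typer of record;
#  content = o6-r1 GEN 10 `HOME/b2b-bsdres-o6-r1/gen10/O6-GEN10.md` (c33acb4cf2523799) §2–§3 with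
#  harvest-2 E87; placement, dedup and Lean phrasing = class typer) — TYPED, EVIDENCE-LABELLED,
#  NOTHING ASSERTED; 0 Literature facts

HONEST FRAMING (cell `b2b-bsdres`, run/shared/lean/b2b/bsd-rank1-residual/, verbatim in every file):
the goal of the cell is to DELETE the COMBINATION-SHAPED residual classes of the Birch–Swinnerton-Dyer
formula for ALL analytic-rank `≤ 1` elliptic curves over `ℚ` — "full BSD formula for every rank `≤ 1`
curve in class `C`" assembled STRICTLY from published theorems — so that the rank-`≤ 1` remainder
becomes exactly the CONSTRUCTION-SHAPED classes, which are TYPED (missing-input `Prop`s), NOT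
attempted. This is not "finishing BSD". Lane CLASS-CLOSURE (`CLASS-CLOSURE-PLAN.md` §3.4 O6;
experiment types (2) OBSTRUCTION ANATOMY → SUB-PARTITION and (3) TRANSPORT SEARCH): research routes;
no claim beyond the stated classes; census output is EVIDENCE, never a Literature fact; nothing is
booked; no mark of `RESIDUAL-MAP.md` moves. Every `@[conjecture] def` below is a census-mined law or
an elementary local statement NOT yet proved in the kernel (lane rule, cc-lead ⟦gen22⟧ (8)(b) /
⟦gen23⟧ (8)(c): closed unproved Summit-side `def : Prop` nodes carry `@[conjecture]` whatever the
docstring grade); the transport statement is a hypothesis SHAPE over the interface binder `KMC`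
(D-O6-2, `O6/O6Targets.lean`), consumed only as an explicit hypothesis. PROVED: table consistency
(`decide`), the partition bookkeeping, the kernel consequences.

## What (o6-r1 GEN 10 §2–§3; universe U = o6-r2 G4 census: 154 058 O6 classes = wild additive
## potentially good at `3`, `N ≤ 500 000`, `ρ̄₃` with no rational `3`-isogeny; residue R-O6-5′ =
## o6-r2 P5 v2 `cls = surplus`, 2 073 classes; files `gen10/shape/shape_summary.json` 593013bc479d0ba5,
## `shape_rows.tsv.gz` 6b9aeab39c0aa0b2, `partner_shape.out` 1932bf0ac33c9572, scripts
## `shape_census.py` 3793c5c21e5d7304 / `partner_shape.py` 9aa9c1b893a701b8 — stdlib, zero kit)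

1. **SHAPE LAW** (EVIDENCE 154 058/154 058, §1 table `shapeCensusV10`): `(v₃N, Kodaira symbol at 3)`
   determines the ORD-side vs ET-side of every locally reducible non-split `W`: Kodaira `{IV*, II*} ↦`
   ORD at `v₃N ∈ {3, 4}`, `{II, IV} ↦` ET there; at `v₃N = 5` it is `{II, II*} ↦` ORD, `{IV, IV*} ↦` ET
   (the `−3` twist adds `6` to `v₃Δ`, `II ↔ IV*`, `IV ↔ II*`, consistently with `ORD ↔ ET`); IRR and SPLIT
   (`W[3]|I₃` tame although `W` is wild — Swan conductor `1`) occur EXACTLY at `(v₃N, Kod) ∈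
   {(3, II), (3, IV*)}`. Typed: `WildThreeResidualShapeByKodaira` (o6-r1's name) + `WildThreeTameTorsionCellLaw`;
   proof route (o6-r1): Tate's algorithm normal forms + explicit `ψ₃`-valuations — a prover's item, the
   census being the certificate that the statement is the right one.
2. **P-SHAPE-PARTNER** (EVIDENCE 20 321 joined classes / 0 violations, §1 table `partnerCensusV10`;
   partners = cc-eng-2 `class-closure/O6/X3E-closed-partner-eng2.tsv`, `W[3] ≅ G[3]` certified by
   Fisher's Hesse families, `G` in a CLOSED cell): the unramified quotient character of `ρ̄|G_{ℚ₃}` is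
   visible in a semistable partner — ORD1 ↔ {good-ordinary ANOMALOUS, SPLIT multiplicative} (`a₃ ≡ +1`),
   ORDM ↔ {good-ordinary non-anomalous, NON-SPLIT multiplicative} (`a₃ ≡ −1`), IRR ↔ good supersingular,
   ET1/ETM ↔ additive partners ONLY. Forced by local Galois theory (ordinary / multiplicative ⇒ sub =
   `ω·`unr; good supersingular ⇒ irreducible): a THEOREM-CANDIDATE, typed `CompanionShapeLawThree` with
   the partner's third `L`-coefficient (`+1` split / `a₃`, `−1` non-split) read mod `3`.
3. **SUB-PARTITION of R-O6-5′ (2 073)** — deliverable "obstruction anatomy", with harvest-2 E87's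
   reading that Fouquet 2025 Ass. 2.9(2) = Fouquet–Wan bullet 2 = Colmez–Wang GENERICITY
   (`ρ̄|G_{ℚ_p} ≄ χ ⊗ (1 ∗; 0 ε̄^{±1})`) is, at `p = 3` where `ε̄ = ω = ω⁻¹`, EXACTLY `LocIrr(3)`:
   (A) `WildResidueA` = IRR 421 (transport announced in print: F25 / FW Thm 1.8; 380 classes with a
   certified seed in the twist-0 cone, 41 not = R-O6-A′); (B) `WildResidueB` = ORD1 156 ∪ ORDM 460 ∪
   SPLIT 109 = 725 (in-class seeds with a PRINTED cyclotomic IMC — Kato + Skinner–Urban, Skinner —,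
   217/725 certified `≤ 500k`; ONLY the non-generic transport M-O6-NG is missing = R-O6-B);
   (C) `WildResidueC` = ET1 576 ∪ ETM 351 = 927 (NO semistable-at-`3` companion in ANY weight; seeds are
   additive potentially good or weight-6 non-ordinary forms: the IRREDUCIBLE CORE R-O6-C, o6-r1's T-O6-U′
   island). Counts `decide`d in §1; PROVED: (A)/(B)/(C) exhaust and are pairwise exclusive.
4. **T-O6-NG, the transport COMPARISON STATEMENT (deliverable (c))**, typed as a hypothesis SHAPE
   `NonGenericTransportShapeThree KMC`: for `W` wild at `3` with big image and `W[3]|G_{ℚ₃}` REDUCIBLE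
   and a congruent companion `G` semistable at `3`, `KMC G 3 → KMC W 3`. Antecedent in print ONLY in
   the generic (= LocIrr at `p = 3`) case: Fouquet–Wan Thm 1.8 / Fouquet 2025 Thm 4.1 [PUB: Tunis. J.
   Math. 7 (2025) 791–829 = arXiv:2501.07105] on Colmez–Wang [PREPRINT arXiv:2104.09200v2, Thm 6
   "générique"]; in the NON-generic block of the `p`-adic local Langlands correspondence in families at
   `p = 3` NO theorem is printed (o6-r1: "the missing input is local-automorphic, not an Euler system and
   not a μ-invariant"). Kernel consequences (PROVED): (B) + seed ⇒ `KMC W 3` under the shape; on (C)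
   the shape is VACUOUS (no semistable seed under `CompanionShapeLawThree`); (A) is served by the
   announced `FouquetWanPointClaimShape` through the elementary dictionary `LocIrr ↔ ShapeIrr`
   (hypothesis `hloc`; kernel proof = harvest-2 E89, landing).

References: O. Fouquet, X. Wan, arXiv:2107.13726 Thm 1.7/1.8, Prop 5.8 [FouquetWan2021]; O. Fouquet,
Tunis. J. Math. 7 (2025) 791–829, Thm 4.1, Prop 2.12, Ass. 2.9(2) [Fouquet2025EquivariantTNC = arXiv:2501.07105];
P. Colmez, S. Wang, arXiv:2104.09200v2 Thm 6 [PREPRINT]; K. Kato, Astérisque 295 (2004) Conj. 12.10,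
Thm 17.4 [Kato2004]; C. Skinner, E. Urban, Invent. Math. 195 (2014) [SkinnerUrban2014]; C. Skinner,
Ann. of Math. 191 (2020) (multiplicative) [Skinner2016]; J.-P. Serre, Invent. Math. 15 (1972) §1.11,
Duke 54 (1987) §2 (weights) [Serre1972, Serre1987]; harvest-2 E87 (`HOME/b2b-bsdres-harvest-2/`);
o6-r1 GEN 10 memo; `cells/o5o6/TARGETS.md` §O6 GEN 10; `class-closure/O6/TYPED.md` §11.
-/

set_option autoImplicit false

noncomputable section

open scoped Classical

open Polynomial WeierstrassCurve Literature.NumberTheory.EllipticCurves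
  Literature.NumberTheory.EllipticCurves.Rank1Residual
  Literature.NumberTheory.EllipticCurves.Rank1Residual.Typed
  Literature.NumberTheory.DiophantineGeometry

namespace Summit.BirchSwinnertonDyer.Rank1Residual.Additive

/-! ## §1 The `(v₃N, Kodaira)` tables and the census of record (kernel-`decide`d consistency) -/

section Tables

/-- **`S(f)`**: the Kodaira symbols at `3` whose locally-reducible non-split rows are ORD-side, by
conductor exponent `f = v₃(N) ∈ {3,4,5}`: `S(3) = S(4) = {IV*, II*}`, `S(5) = {II, II*}` (o6-r1 V10).
Junk (`false`) off the wild range. [folklore] -/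
def ordSideKodairaThree : ℕ → KodairaSymbol → Bool
  | 3, .IVstar | 3, .IIstar | 4, .IVstar | 4, .IIstar | 5, .II | 5, .IIstar => true
  | _, _ => false

/-- The two cells `(v₃N, Kod) ∈ {(3, II), (3, IV*)}` where `W[3]|I₃` can be TAME (shapes IRR / SPLIT).
[folklore] -/
def tameTorsionCellThree : ℕ → KodairaSymbol → Bool
  | 3, .II | 3, .IVstar => true
  | _, _ => false

/-- One row of the V10 SHAPE census: `(v₃N, v₃Δ_min, Kodaira at 3)` and the six shape counts in U,
with the R-O6-5′ counts of the same cell. [folklore] -/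
structure ShapeCensusRow where
  condExp : ℕ
  valDisc : ℕ
  kod : KodairaSymbol
  (ord1 ordm et1 etm irr split : ℕ)
  (resOrd1 resOrdm resEt1 resEtm resIrr resSplit : ℕ)
  deriving DecidableEq, Repr

/-- Row total in U. [folklore] -/
def ShapeCensusRow.total (r : ShapeCensusRow) : ℕ := r.ord1 + r.ordm + r.et1 + r.etm + r.irr + r.split

/-- Row total in R-O6-5′. [folklore] -/
def ShapeCensusRow.resTotal (r : ShapeCensusRow) : ℕ :=
  r.resOrd1 + r.resOrdm + r.resEt1 + r.resEtm + r.resIrr + r.resSplit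

/-- A row OBEYS the shape law: ORD counts only where `S(f)` holds, ET counts only where it fails,
IRR/SPLIT counts only on the two tame-torsion cells. [folklore] -/
def ShapeCensusRow.obeys (r : ShapeCensusRow) : Bool :=
  (r.ord1 + r.ordm == 0 || ordSideKodairaThree r.condExp r.kod) &&
  (r.et1 + r.etm == 0 || !ordSideKodairaThree r.condExp r.kod) &&
  (r.irr + r.split == 0 || tameTorsionCellThree r.condExp r.kod)

/-- **The V10 SHAPE census of record** (o6-r1 GEN 10, `partner_shape.out` §1 / `O6-GEN10.md` §2;
U = 154 058 classes; R-O6-5′ counts after the bar). EVIDENCE. [folklore] -/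
def shapeCensusV10 : List ShapeCensusRow :=
  [⟨3, 3, .II, 0, 0, 5212, 5420, 12071, 7697, 0, 0, 6, 4, 29, 2⟩,
   ⟨3, 5, .IV, 0, 0, 10825, 10936, 0, 0, 0, 0, 321, 333, 0, 0⟩,
   ⟨3, 9, .IVstar, 5504, 4603, 0, 0, 11848, 7241, 5, 278, 0, 0, 392, 107⟩,
   ⟨3, 11, .IIstar, 12987, 13121, 0, 0, 0, 0, 22, 29, 0, 0, 0, 0⟩,
   ⟨4, 4, .II, 0, 0, 4986, 5042, 0, 0, 0, 0, 4, 9, 0, 0⟩,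
   ⟨4, 6, .IV, 0, 0, 2246, 3188, 0, 0, 0, 0, 91, 3, 0, 0⟩,
   ⟨4, 10, .IVstar, 4958, 4954, 0, 0, 0, 0, 127, 145, 0, 0, 0, 0⟩,
   ⟨4, 12, .IIstar, 3305, 3370, 0, 0, 0, 0, 1, 5, 0, 0, 0, 0⟩,
   ⟨5, 5, .II, 2166, 2225, 0, 0, 0, 0, 0, 2, 0, 0, 0, 0⟩,
   ⟨5, 7, .IV, 0, 0, 1099, 1666, 0, 0, 0, 0, 59, 1, 0, 0⟩,
   ⟨5, 11, .IVstar, 0, 0, 1804, 2342, 0, 0, 0, 0, 95, 1, 0, 0⟩,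
   ⟨5, 13, .IIstar, 1572, 1670, 0, 0, 0, 0, 1, 1, 0, 0, 0, 0⟩]

/-- The census covers all of U: `Σ = 154 058`. [folklore] -/
theorem shapeCensusV10_total : (shapeCensusV10.map ShapeCensusRow.total).sum = 154058 := by decide

/-- … and all of R-O6-5′: `Σ = 2 073`. [folklore] -/
theorem shapeCensusV10_resTotal : (shapeCensusV10.map ShapeCensusRow.resTotal).sum = 2073 := by decide

/-- **SHAPE LAW, 0 exceptions in U**: every census row obeys `S(f)` and the tame-torsion cells.
[folklore] -/
theorem shapeCensusV10_obeys : ∀ r ∈ shapeCensusV10, r.obeys = true := by decide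

/-- The (A)/(B)/(C) counts of R-O6-5′: IRR 421; ORD1 + ORDM + SPLIT = 156 + 460 + 109 = 725;
ET1 + ETM = 576 + 351 = 927. [folklore] -/
theorem shapeCensusV10_residueABC :
    (shapeCensusV10.map (·.resIrr)).sum = 421 ∧
    (shapeCensusV10.map fun r ↦ r.resOrd1 + r.resOrdm + r.resSplit).sum = 725 ∧
    (shapeCensusV10.map fun r ↦ r.resEt1 + r.resEtm).sum = 927 := by decide

/-- Partner types at `3` of a certified CLOSED congruence partner (cc-eng-2 X3E). [folklore] -/
inductive PartnerTypeThree
  | additive | goodOrd | goodOrdAnomalous | goodSS | multNonsplit | multSplit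
  deriving DecidableEq, Repr

/-- The shape of `W` a semistable partner type is COMPATIBLE with (P-SHAPE-PARTNER): additive partners
carry no constraint; ORD1 ↔ anomalous / split; ORDM ↔ non-anomalous ordinary / non-split; IRR ↔
supersingular; SPLIT ↔ any non-supersingular semistable type; ET1/ETM ↔ none. [folklore] -/
def partnerCompatibleThree : String → PartnerTypeThree → Bool
  | _, .additive | "ORD1", .goodOrdAnomalous | "ORD1", .multSplit | "ORDM", .goodOrd
  | "ORDM", .multNonsplit | "IRR", .goodSS | "SPLIT", .goodOrd | "SPLIT", .goodOrdAnomalous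
  | "SPLIT", .multNonsplit | "SPLIT", .multSplit => true
  | _, _ => false

/-- **P-SHAPE-PARTNER census of record** (`partner_shape.out` §2; 20 321 joined classes): per shape the
counts of partner types `[additive, goodOrd, goodOrdAnomalous, goodSS, multNonsplit, multSplit]`.
EVIDENCE. [folklore] -/
def partnerCensusV10 : List (String × List ℕ) :=
  [("ORD1", [6, 0, 930, 0, 0, 2765]), ("ORDM", [10, 1660, 0, 0, 2995, 0]),
   ("SPLIT", [24, 522, 991, 0, 10, 41]), ("ET1", [3863, 0, 0, 0, 0, 0]),
   ("ETM", [3151, 0, 0, 0, 0, 0]), ("IRR", [1061, 0, 0, 2292, 0, 0])]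

/-- Column order of `partnerCensusV10`. [folklore] -/
def partnerTypesInOrder : List PartnerTypeThree :=
  [.additive, .goodOrd, .goodOrdAnomalous, .goodSS, .multNonsplit, .multSplit]

/-- **0 violations on 20 321 classes**: a non-zero count occurs only at a compatible
(shape, partner type). [folklore] -/
theorem partnerCensusV10_violations_zero :
    (∀ row ∈ partnerCensusV10,
      (List.zip partnerTypesInOrder row.2).all fun tc ↦ tc.2 == 0 || partnerCompatibleThree row.1 tc.1)
    ∧ (partnerCensusV10.map fun row ↦ row.2.sum).sum = 20321 := by decide

end Tables

/-! ## §2 The SHAPE LAW and the partner law (census-mined; `@[conjecture]` until a kernel proof) -/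

section Laws

/-- **SHAPE LAW `WildThreeResidualShapeByKodaira` (o6-r1 GEN 10 V10; EVIDENCE 154 058/154 058 →
LEMMA CANDIDATE).**  For `W/ℚ` additive and WILD at `3` (`v₃(N) ∈ {3,4,5}`, potentially good) whose
`W[3]|G_{ℚ₃}` is reducible and non-split, the inertial character of the stable line is `ω·`(unramified)
— shape ORD1/ORDM — iff `Kod₃(W) ∈ S(v₃N)`, `S(3) = S(4) = {IV*, II*}`, `S(5) = {II, II*}`; otherwise it is
unramified·(quotient ramified) — shape ET1/ETM. Why it might fail: it cannot fail by a census count in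
U (0/154 058), only by a curve outside U's conventions (the statement is LOCAL; U carries the global
restriction "no rational 3-isogeny", irrelevant to it). Proof route: Tate's algorithm normal forms at a
wild `3` (Kraus 1990 / Papadopoulos) + the `3`-adic Newton polygon of `ψ₃` and the square class of
`Ψ₂²(x₀)`. Not found in print in this form. KERNEL REFORMULATION (cc-typer-5 GEN 10 restamp; the node stays
`@[conjecture]`, nothing asserted about it): x11b3-p8 GEN 15's `wildThreeResidualShapeByKodaira_iff_even_c₆`
(`Additive/WildThreeStableLineSignByC6.lean` p306118, on `PsiThreeHenselRootSign.lean` p305746) proves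
`WildThreeResidualShapeByKodaira ↔ ∀ W, ClassO6 W 3 → (∃ x₀, IsUniqueStableLineThree W x₀) →
(ordSideKodairaThree (condExp W 3) (Kod₃ W) = true ↔ Even (v₃ c₆))` — the stable-line sign is `(−1/216)·c₆·`(unit
`≡ 1`) (`stableLineSignThree_eq_c₆_mul`), so the law is a statement about the PARITY of `v₃(c₆)` per wild cell, to be
settled by Tate's algorithm at `3` (cf. x11b3-p6's `valuation_signature_of_wild_shape` p304828 for the `LocIrr` cells).
[evidence: census cell O6, o6-r1 GEN 10 V10 `shape_summary.json` 593013bc479d0ba5: table `shapeCensusV10`, 0 exceptions]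
[cite: Kraus1990, Théorème (p = 3)] [cite: Serre1972, §1.11] -/
@[conjecture] def WildThreeResidualShapeByKodaira : Prop :=
  ∀ (W : WeierstrassCurve ℚ) [W.IsElliptic] [W.IsGloballyMinimal], ClassO6 W 3 →
    (ShapeOrdSideThree W → ordSideKodairaThree (condExp W 3) (W.kodairaSymbolAt (placeOf 3)) = true) ∧
    (ShapeEtSideThree W → ordSideKodairaThree (condExp W 3) (W.kodairaSymbolAt (placeOf 3)) = false)

/-- **Tame-torsion cells `WildThreeTameTorsionCellLaw` (o6-r1 V10; EVIDENCE → LEMMA CANDIDATE).**  IRR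
and SPLIT — the shapes with `W[3]|I₃` tame (the wild inertia image dies in `GL₂(𝔽₃)`, possible only at
Swan conductor `1`) — occur ONLY at `(v₃N, Kod₃) ∈ {(3, II), (3, IV*)}` (`v₃Δ ∈ {3, 9}`); inside that
locus the selector of `Additive/LocIrrValuationCriterionThree` separates IRR.
[evidence: census cell O6, o6-r1 GEN 10 V10: IRR 23 919 + SPLIT 14 938 classes, all in the two cells]
[cite: Kraus1990, Théorème (p = 3)] -/
@[conjecture] def WildThreeTameTorsionCellLaw : Prop :=
  ∀ (W : WeierstrassCurve ℚ) [W.IsElliptic] [W.IsGloballyMinimal], ClassO6 W 3 →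
    (ShapeIrrThree W ∨ ShapeSplitThree W) →
      tameTorsionCellThree (condExp W 3) (W.kodairaSymbolAt (placeOf 3)) = true

/-- **The dictionary `LocIrr W 3 ↔ ShapeIrrThree W`** (`W[3]` irreducible as a `G_{ℚ₃}`-module iff `Ψ₃`
has no root in `ℚ₃`: a subgroup `{0, ±P}` of order `3` is stable iff `x(P) ∈ ℚ₃`; Serre 1972 §1.11) is
NOT a node of this file: it is being PROVED in the kernel by harvest-2 (E89, Literature lemma
`hasIrreducibleModPGaloisRep_three_iff_forall_not_isRoot_Ψ₃` + Summit corollaries) and is consumed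
below as an explicit hypothesis `hloc`, to be instantiated by that theorem composed with
`shapeIrrThree_iff_numStableLines_eq_zero`.  This bridge records that O5's restricted node follows.
[cite: Serre1972, §1.11 Prop. 10] -/
theorem localShapeTprimeThree_of_locIrr_iff_shapeIrr
    (hloc : ∀ (W : WeierstrassCurve ℚ) [W.IsElliptic] [W.IsGloballyMinimal], LocIrr W 3 ↔ ShapeIrrThree W) :
    O5.LocalShapeTprimeThree := by
  intro W _ _ _ _
  rw [hloc W, shapeIrrThree_iff_numStableLines_eq_zero]

/-- **P-SHAPE-PARTNER `CompanionShapeLawThree` (THEOREM-CANDIDATE by local Galois theory; EVIDENCE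
20 321/0).**  Let `W` be wild at `3` with `ρ̄_{W,3}` irreducible and `G` a companion SEMISTABLE at `3`
(`O5.IsCompanionAtThree`: `9 ∤ N_G`, `a_ℓ(W) ≡ a_ℓ(G) (mod 3)` off `3N_WN_G`, so `ρ̄_G ≅ ρ̄_W`).  Read the
third coefficient `c₃(G)` of `L(G,s)` (`= a₃(G)` if good, `+1` split, `−1` non-split multiplicative).
Then: `W` is NOT ET-side (an ET class has no semistable companion in any weight); `W` is IRR iff
`3 ∣ c₃(G)` (good supersingular); ORD1 ⇒ `c₃(G) ≡ 1` (anomalous or split: unramified quotient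
trivial); ORDM ⇒ `c₃(G) ≡ −1` (non-anomalous ordinary or non-split: quotient `μ`).  Mechanism:
ordinary/multiplicative ⇒ `ρ̄_G|G_{ℚ₃} = (ω·u⁻¹ ∗; 0 u)` with `u(Frob) = ā₃`; good supersingular ⇒
irreducible (`ω₂ ⊕ ω₂³`); a shape is an invariant of `ρ̄|G_{ℚ₃}`.  The census is an end-to-end check of
both engines (this seat's reading: the law is what makes cc-eng-2's partner table an INSTRUMENT for (B)).
[cite: Serre1972, §1.11 Props. 11–12] [cite: Edixhoven1992, Thms. 2.5–2.6]
[evidence: census cell O6, o6-r1 GEN 10 P-SHAPE-PARTNER `partner_shape.out` 1932bf0ac33c9572: table `partnerCensusV10`, 20 321 classes, 0 violations] -/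
@[conjecture] def CompanionShapeLawThree : Prop :=
  ∀ (W G : WeierstrassCurve ℚ) [W.IsElliptic] [W.IsGloballyMinimal] [G.IsElliptic] [G.IsGloballyMinimal],
    ClassO6 W 3 → W.HasIrreducibleModPGaloisRep 3 → O5.IsCompanionAtThree W G →
      ¬ ShapeEtSideThree W ∧
      (ShapeIrrThree W ↔ ((G.LFunction 3 : ℤ) : ZMod 3) = 0) ∧
      (ShapeORD1Three W → ((G.LFunction 3 : ℤ) : ZMod 3) = 1) ∧
      (ShapeORDMThree W → ((G.LFunction 3 : ℤ) : ZMod 3) = -1)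

end Laws

/-! ## §3 The sub-partition (A)/(B)/(C) of the wild residue by shape (typed by name; PROVED partition) -/

section SubPartition

variable (W : WeierstrassCurve ℚ)

/-- **(A) = R-O6-A**: `W[3]|G_{ℚ₃}` irreducible (`LocIrr`, the GENERIC block at `p = 3`). In R-O6-5′:
421 classes (`v₃N = 3`: II 29, IV* 392); 380 covered by the F25 cone with a certified seed, 41 not
(R-O6-A′). Transport: `FouquetWanPointClaimShape` (announced). [folklore] -/
def WildResidueA : Prop := ShapeIrrThree W

/-- **(B) = R-O6-B, "ordinary-type `ρ̄`"**: a stable line of character `ω·`unramified (ORD1, ORDM) or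
split. In R-O6-5′: ORD1 156 ∪ ORDM 460 ∪ SPLIT 109 = 725; in-class seeds with a PRINTED cyclotomic
IMC exist generically (Kato + Skinner–Urban; Skinner), 217/725 certified `≤ 500k`; the ONLY missing
piece is the non-generic transport `NonGenericTransportShapeThree`. The 'extends near-verbatim
modulo ONE comparison statement' part of O6 — for provers. [folklore] -/
def WildResidueB : Prop := ShapeOrdSideThree W ∨ ShapeSplitThree W

/-- **(C) = R-O6-C, "`ω`-twisted ordinary-type `ρ̄`"**: stable line unramified, quotient ramified (ET1,
ETM). In R-O6-5′: ET1 576 ∪ ETM 351 = 927; NO semistable-at-`3` companion in any weight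
(`CompanionShapeLawThree`), no printed IMC to transport even granted M-O6-NG: the IRREDUCIBLE CORE of
O6, named for ideation (o6-r1 T-O6-U′ on its interpolable island `C1`, LOG-TYPE on `C2`). [folklore] -/
def WildResidueC : Prop := ShapeEtSideThree W

/-- **(A) ∨ (B) ∨ (C) is everything** (given the automatic non-vanishing of the stable-line sign):
no class of the residue is lost. [folklore] -/
theorem wildResidue_exhaustive
    (hF : ∀ x₀ : ℚ_[3], IsUniqueStableLineThree W x₀ → stableLineSignThree W x₀ ≠ 0) :
    WildResidueA W ∨ WildResidueB W ∨ WildResidueC W := by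
  rcases shape_exhaustive W hF with h | h | h | h | h | h
  · exact Or.inl h
  · exact Or.inr (Or.inl (Or.inr h))
  · exact Or.inr (Or.inr (Or.inl h))
  · exact Or.inr (Or.inr (Or.inr h))
  · exact Or.inr (Or.inl (Or.inl (Or.inl h)))
  · exact Or.inr (Or.inl (Or.inl (Or.inr h)))

/-- (A) meets neither (B) nor (C). [folklore] -/
theorem WildResidueA.not_B_not_C {W : WeierstrassCurve ℚ} (h : WildResidueA W) :
    ¬ WildResidueB W ∧ ¬ WildResidueC W := by
  obtain ⟨hs, h1, h2, h3, h4⟩ := ShapeIrrThree.not_others h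
  exact ⟨fun hB ↦ hB.elim (fun ho ↦ ho.elim h3 h4) hs, fun hC ↦ hC.elim h1 h2⟩

/-- (B) and (C) are exclusive. [folklore] -/
theorem WildResidueB.not_C {W : WeierstrassCurve ℚ} (h : WildResidueB W) : ¬ WildResidueC W := by
  intro hC
  rcases h with ho | hs
  · exact shapeEtSide_not_ordSide hC ho
  · obtain ⟨h1, h2, -, -⟩ := ShapeSplitThree.not_oneLine hs
    exact hC.elim h1 h2

end SubPartition

/-! ## §4 T-O6-NG: the non-generic transport SHAPE over `KMC`, and what it buys per class (PROVED) -/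

section Transport

variable (KMC : ∀ (W : WeierstrassCurve ℚ) [W.IsElliptic] [W.IsGloballyMinimal] (p : ℕ), Prop)

/-- **T-O6-NG `NonGenericTransportShapeThree` — the COMPARISON STATEMENT class (B) needs** (a
hypothesis SHAPE over the interface `KMC` = Kato's main conjecture at `(f_E, 3)`, D-O6-2; NOT a
theorem of record, NOT a Literature fact, no printed antecedent in the non-generic case).  For `W/ℚ`
additive and wild at `3` with `ρ̄_{W,3}(G_ℚ) ⊇ SL₂(𝔽₃)` and `W[3]|G_{ℚ₃}` REDUCIBLE (the non-generic
block `χ ⊗ (1 ∗; 0 ω^{±1})` at `p = 3`), and a companion `G` semistable at `3` with `ρ̄_G ≅ ρ̄_W`: Kato's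
main conjecture TRANSPORTS from `G` to `W`.  The generic analogue (`LocIrr`) is Fouquet–Wan Thm 1.8 /
Fouquet 2025 Thm 4.1 via Colmez–Wang's generic interpolation of the `p`-adic local Langlands functor;
the missing input here is local-automorphic (o6-r1 GEN 10 §3, harvest-2 E87 §2.2). Consumed only as an
explicit hypothesis `(hNG : NonGenericTransportShapeThree KMC)`.
[cite: FouquetWan2021, Thm. 1.8 (p. 6)] [cite: Fouquet2025EquivariantTNC, Thm. 4.1 and Ass. 2.9(2)] -/
def NonGenericTransportShapeThree : Prop :=
  ∀ (W G : WeierstrassCurve ℚ) [W.IsElliptic] [W.IsGloballyMinimal] [G.IsElliptic] [G.IsGloballyMinimal],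
    ClassO6 W 3 → Kato2004.ImageContainsSL2 W 3 → ¬ ShapeIrrThree W →
    O5.IsCompanionAtThree W G → KMC G 3 → KMC W 3

variable {KMC}

/-- **Class (B) under the shape**: a semistable seed `G` with `KMC G 3` gives `KMC W 3`. [folklore] -/
theorem kmc_three_of_nonGenericTransport (hNG : NonGenericTransportShapeThree KMC)
    (W G : WeierstrassCurve ℚ) [W.IsElliptic] [W.IsGloballyMinimal] [G.IsElliptic] [G.IsGloballyMinimal]
    (hO6 : ClassO6 W 3) (himg : Kato2004.ImageContainsSL2 W 3) (hB : WildResidueB W)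
    (hcomp : O5.IsCompanionAtThree W G) (hseed : KMC G 3) : KMC W 3 := by
  refine hNG W G hO6 himg ?_ hcomp hseed
  intro hirr
  exact (WildResidueA.not_B_not_C hirr).1 hB

/-- **Class (C) is the irreducible core**: under the partner law an ET-side `W` has NO semistable
companion at `3` at all, so `NonGenericTransportShapeThree` is vacuous there (no seed to transport
from). [folklore] -/
theorem no_semistable_companion_of_residueC (hlaw : CompanionShapeLawThree)
    (W G : WeierstrassCurve ℚ) [W.IsElliptic] [W.IsGloballyMinimal] [G.IsElliptic] [G.IsGloballyMinimal]
    (hO6 : ClassO6 W 3) (hirr : W.HasIrreducibleModPGaloisRep 3) (hC : WildResidueC W) :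
    ¬ O5.IsCompanionAtThree W G :=
  fun hcomp ↦ (hlaw W G hO6 hirr hcomp).1 hC

/-- **Class (A) is already served by the announced point shape** (`FouquetWanPointClaimShape`, Fouquet–Wan
Thm 1.8 read at `f_E`), through the dictionary `LocIrr ↔ ShapeIrr` (`hloc`) and a non-split witness prime.
[folklore] -/
theorem kmc_three_of_fwPointClaim_of_residueA (hFW : FouquetWanPointClaimShape KMC)
    (hloc : ∀ (W : WeierstrassCurve ℚ) [W.IsElliptic] [W.IsGloballyMinimal], LocIrr W 3 ↔ ShapeIrrThree W)
    (W : WeierstrassCurve ℚ) [W.IsElliptic] [W.IsGloballyMinimal]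
    (himg : Kato2004.ImageContainsSL2 W 3) (hA : WildResidueA W)
    (hwit : FWNonsplitRam W 3 ∨ ∃ (q : ℕ) (_ : Fact q.Prime), FWNonsplitAddThree W q) : KMC W 3 :=
  hFW W himg ((hloc W).2 hA) hwit

/-- **Under the partner law a semistable companion of an IRR class is supersingular at `3`** (`3 ∣ c₃(G)`)
— the seed type of (A) — and of a (B) class is ordinary or multiplicative (`3 ∤ c₃(G)`) — the seed
type with a PRINTED cyclotomic main conjecture. [folklore] -/
theorem seedType_of_companionShapeLaw (hlaw : CompanionShapeLawThree)
    (W G : WeierstrassCurve ℚ) [W.IsElliptic] [W.IsGloballyMinimal] [G.IsElliptic] [G.IsGloballyMinimal]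
    (hO6 : ClassO6 W 3) (hirr : W.HasIrreducibleModPGaloisRep 3)
    (hcomp : O5.IsCompanionAtThree W G) :
    (WildResidueA W → ((G.LFunction 3 : ℤ) : ZMod 3) = 0) ∧
    (WildResidueB W → ((G.LFunction 3 : ℤ) : ZMod 3) ≠ 0) := by
  obtain ⟨hnotC, hirrIff, -, -⟩ := hlaw W G hO6 hirr hcomp
  refine ⟨fun hA ↦ hirrIff.1 hA, fun hB h0 ↦ ?_⟩
  exact (WildResidueA.not_B_not_C (hirrIff.2 h0)).1 hB

end Transport

end Summit.BirchSwinnertonDyer.Rank1Residual.Additive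

end
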